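import Summits.KontsevichZagierPeriods.KontsevichZagierPeriods.Theorems.HurwitzMicroSectorsNormalFormPrincipleDlogMoves
import Summits.KontsevichZagierPeriods.KontsevichZagierPeriods.Theorems.HurwitzMicroSectorsNormalFormPrincipleAlgDlogMoves
import Summits.KontsevichZagierPeriods.KontsevichZagierPeriods.Theorems.HurwitzMicroSectorsNormalFormPrincipleAlgBaker

/-!
# `NormalFormPrinciple` (stmt-KontsevichZagierPeriods-3869), stub `box_algsplit_mem_relations`
# (siege k5, Mathlib API route), II: the carriers `Λ(u, c) = [(1,u), c/y]` are multiplicative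

Pure proof file (`--supports` the crux stmt-KontsevichZagierPeriods-3869). The carriers of the
algebraic normal form (file I, `…AlgSplitK5NormalForm.lean`) are the representations
`Λ(u, c) = [(1,u), c/y]` (`u ≥ 1`, `c` real algebraic; value `c log u`). With only the moves of
rules (1a) (splitting at an interior point) and (2) (the dilation `y ↦ u·y`) — landed as
`Dlog.split_mem_relations` and `Dlog.dlogA_scale_mem_relations` — we prove, modulo `KZ.relations`:

* `carrier_mul_mem_relations`: `Λ(uv, c) ≡ Λ(u, c) + Λ(v, c)` for real algebraic `u, v ≥ 1`;
* `carrier_pow_sub_nsmul_mem_relations`: `Λ(uⁿ, c) ≡ n • Λ(u, c)`;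
* `carrier_prod_pow_sub_sum_mem_relations`: `Λ(∏ εᵢ^{mᵢ}, c) ≡ Σ mᵢ • Λ(εᵢ, c)` (`mᵢ ∈ ℕ`);
* `carrier_monomial_sub_sum_mem_relations` (registered sub-goal): for INTEGER exponents `nᵢ` with
  `u = ∏ εᵢ^{nᵢ} ≥ 1`, `Λ(u, c) ≡ Σ nᵢ • Λ(εᵢ, c)` — negative exponents are cleared by multiplying
  through (`u · ∏ εᵢ^{(−nᵢ)⁺} = ∏ εᵢ^{nᵢ⁺}`), never by dividing.

Sources: M. Kontsevich, D. Zagier, *Periods* (2001), §1.1 (`log 2 = ∫₁² dx/x`), §1.2 rules (1), (2).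
No definitions are introduced.
-/

noncomputable section

open MeasureTheory Set Finset
open Literature.NumberTheory.Transcendental Literature.NumberTheory.Transcendental.KZ
open Literature.ModelTheory.ExponentialFields (IsSemialgebraic)

namespace Summit.KontsevichZagierPeriods.HurwitzMicroSectors.NormalFormPrinciple.PiBox

namespace AlgSplitK5

open Dlog

/-! ## Algebraicity and size of products of powers -/

/-- A finite product of natural powers of real algebraic numbers is algebraic. [folklore] -/
theorem isAlgebraic_prod_pow {ι : Type*} (t : Finset ι) (a : ι → ℝ) (m : ι → ℕ)
    (ha : ∀ i ∈ t, IsAlgebraic ℚ (a i)) : IsAlgebraic ℚ (∏ i ∈ t, a i ^ m i) := by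
  have h := isAlgebraic_prod_zpow t a (fun i => (m i : ℤ)) ha
  simpa [zpow_natCast] using h

/-- A finite product of natural powers of reals `≥ 1` is `≥ 1`. [folklore] -/
theorem one_le_prod_pow {ι : Type*} (t : Finset ι) (a : ι → ℝ) (m : ι → ℕ)
    (ha : ∀ i ∈ t, 1 ≤ a i) : 1 ≤ ∏ i ∈ t, a i ^ m i :=
  Finset.prod_induction _ (fun x : ℝ => 1 ≤ x) (fun _ _ hx hy => one_le_mul_of_one_le_of_one_le hx hy)
    le_rfl fun i hi => one_le_pow₀ (ha i hi)

/-! ## Multiplicativity of the carriers -/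

/-- **`Λ(uv, c) ≡ Λ(u, c) + Λ(v, c)`** for real algebraic `u, v ≥ 1` and algebraic `c`: split
`(1, uv)` at `u` (rule 1a) and carry `(u, uv)` to `(1, v)` by the dilation `y ↦ u·y` (rule 2).
[cite: KontsevichZagier2001, §1.2 rules (1), (2)] -/
theorem carrier_mul_mem_relations {u v c : ℝ} (hu : IsAlgebraic ℚ u) (hv : IsAlgebraic ℚ v)
    (hc : IsAlgebraic ℚ c) (hu1 : 1 ≤ u) (hv1 : 1 ≤ v) (Luv Lu Lv : IntegralRep 1)
    (hduv : Luv.domain = {x : Fin 1 → ℝ | x 0 ∈ Set.Ioo 1 (u * v)})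
    (hiuv : Luv.integrand = fun x => c / x 0)
    (hdu : Lu.domain = {x : Fin 1 → ℝ | x 0 ∈ Set.Ioo 1 u}) (hiu : Lu.integrand = fun x => c / x 0)
    (hdv : Lv.domain = {x : Fin 1 → ℝ | x 0 ∈ Set.Ioo 1 v}) (hiv : Lv.integrand = fun x => c / x 0) :
    of Luv - of Lu - of Lv ∈ relations := by
  have hu0 : 0 < u := lt_of_lt_of_le one_pos hu1
  -- the middle piece `[(u, uv), c/y]`
  obtain ⟨M, hMd, hMi⟩ := exists_dlogA hu (hu.mul hv) hc hu0 (b := u * v)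
  have h1 : of Luv - of Lu - of M ∈ relations :=
    split_mem_relations Luv Lu M hduv hdu hMd hu1 (le_mul_of_one_le_right hu0.le hv1)
      (by rw [hiu, hiuv]; exact fun _ _ => rfl) (by rw [hMi, hiuv]; exact fun _ _ => rfl)
  have h2 : of Lv - of M ∈ relations :=
    dlogA_scale_mem_relations hu Lv M hdv (by rw [hMd, mul_one]) (by rw [hiv]; exact fun _ _ => rfl)
      (by rw [hMi]; exact fun _ _ => rfl) one_pos hu0
  have : of Luv - of Lu - of Lv = (of Luv - of Lu - of M) - (of Lv - of M) := by abel
  rw [this]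
  exact relations.sub_mem h1 h2

/-- **`Λ(uⁿ, c) ≡ n • Λ(u, c)`** for real algebraic `u ≥ 1` (induction on `n`; `Λ(1, c)` has empty
domain). [cite: KontsevichZagier2001, §1.2 rules (1), (2)] -/
theorem carrier_pow_sub_nsmul_mem_relations {u c : ℝ} (hu : IsAlgebraic ℚ u) (hc : IsAlgebraic ℚ c)
    (hu1 : 1 ≤ u) (L1 : IntegralRep 1) (hd1 : L1.domain = {x : Fin 1 → ℝ | x 0 ∈ Set.Ioo 1 u})
    (hi1 : L1.integrand = fun x => c / x 0) :
    ∀ (n : ℕ) (L : IntegralRep 1), L.domain = {x : Fin 1 → ℝ | x 0 ∈ Set.Ioo 1 (u ^ n)} →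
      (L.integrand = fun x => c / x 0) → of L - n • of L1 ∈ relations
  | 0, L, hLd, _ => by
    rw [zero_nsmul, sub_zero]
    exact slab_empty_mem_relations L (by rw [hLd, pow_zero]) le_rfl
  | n + 1, L, hLd, hLi => by
    obtain ⟨M, hMd, hMi⟩ := exists_dlogA isAlgebraic_one (hu.pow n) hc one_pos (b := u ^ n)
    have h1 : of L - of M - of L1 ∈ relations :=
      carrier_mul_mem_relations (hu.pow n) hu hc (one_le_pow₀ hu1) hu1 L M L1
        (by rw [hLd, pow_succ]) hLi hMd hMi hd1 hi1
    have h2 : of M - n • of L1 ∈ relations := carrier_pow_sub_nsmul_mem_relations hu hc hu1 L1 hd1 hi1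
      n M hMd hMi
    rw [succ_nsmul]
    have : of L - (n • of L1 + of L1) = (of L - of M - of L1) + (of M - n • of L1) := by abel
    rw [this]
    exact relations.add_mem h1 h2

/-- **`Λ(∏_{i ∈ t} εᵢ^{mᵢ}, c) ≡ Σ_{i ∈ t} mᵢ • Λ(εᵢ, c)`** for real algebraic `εᵢ ≥ 1`, natural
exponents `mᵢ` and algebraic `c` (induction on the finite set `t`).
[cite: KontsevichZagier2001, §1.2 rules (1), (2)] -/
theorem carrier_prod_pow_sub_sum_mem_relations {s : ℕ} {ε : Fin s → ℝ} (hε1 : ∀ i, 1 ≤ ε i)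
    (hεalg : ∀ i, IsAlgebraic ℚ (ε i)) {c : ℝ} (hc : IsAlgebraic ℚ c) (m : Fin s → ℕ)
    (L1 : Fin s → IntegralRep 1) (hd1 : ∀ i, (L1 i).domain = {x : Fin 1 → ℝ | x 0 ∈ Set.Ioo 1 (ε i)})
    (hi1 : ∀ i, (L1 i).integrand = fun x => c / x 0) :
    ∀ (t : Finset (Fin s)) (L : IntegralRep 1),
      L.domain = {x : Fin 1 → ℝ | x 0 ∈ Set.Ioo 1 (∏ i ∈ t, ε i ^ m i)} →
      (L.integrand = fun x => c / x 0) → of L - ∑ i ∈ t, m i • of (L1 i) ∈ relations := by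
  intro t
  induction t using Finset.induction_on with
  | empty =>
    intro L hLd _
    rw [Finset.sum_empty, sub_zero]
    exact slab_empty_mem_relations L (by rw [hLd, Finset.prod_empty]) le_rfl
  | insert a t ha ih =>
    intro L hLd hLi
    have halgP : IsAlgebraic ℚ (∏ i ∈ t, ε i ^ m i) := isAlgebraic_prod_pow t ε m fun i _ => hεalg i
    have h1P : 1 ≤ ∏ i ∈ t, ε i ^ m i := one_le_prod_pow t ε m fun i _ => hε1 i
    obtain ⟨Ma, hMad, hMai⟩ := exists_dlogA isAlgebraic_one ((hεalg a).pow (m a)) hc one_pos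
      (b := ε a ^ m a)
    obtain ⟨Mt, hMtd, hMti⟩ := exists_dlogA isAlgebraic_one halgP hc one_pos (b := ∏ i ∈ t, ε i ^ m i)
    have h1 : of L - of Ma - of Mt ∈ relations :=
      carrier_mul_mem_relations ((hεalg a).pow (m a)) halgP hc (one_le_pow₀ (hε1 a)) h1P L Ma Mt
        (by rw [hLd, Finset.prod_insert ha]) hLi hMad hMai hMtd hMti
    have h2 : of Ma - m a • of (L1 a) ∈ relations :=
      carrier_pow_sub_nsmul_mem_relations (hεalg a) hc (hε1 a) (L1 a) (hd1 a) (hi1 a) (m a) Ma hMad hMai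
    have h3 : of Mt - ∑ i ∈ t, m i • of (L1 i) ∈ relations := ih Mt hMtd hMti
    rw [Finset.sum_insert ha]
    have : of L - (m a • of (L1 a) + ∑ i ∈ t, m i • of (L1 i)) =
        (of L - of Ma - of Mt) + (of Ma - m a • of (L1 a)) + (of Mt - ∑ i ∈ t, m i • of (L1 i)) := by
      abel
    rw [this]
    exact relations.add_mem (relations.add_mem h1 h2) h3

/-- Clearing negative exponents: `ε^{n} · ε^{(−n)⁺} = ε^{n⁺}` for `ε ≠ 0` and `n ∈ ℤ`. [folklore] -/
theorem zpow_mul_pow_toNat_neg {ε : ℝ} (hε : ε ≠ 0) (n : ℤ) :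
    ε ^ n * ε ^ (-n).toNat = ε ^ n.toNat := by
  rw [← zpow_natCast, ← zpow_natCast, ← zpow_add₀ hε]
  congr 1
  have := Int.toNat_sub_toNat_neg n
  omega

/-- **Exact monomials** (registered sub-goal of the siege): if `εᵢ ≥ 1` are real algebraic,
`nᵢ ∈ ℤ` and `u = ∏ᵢ εᵢ^{nᵢ} ≥ 1`, then `Λ(u, c) ≡ Σᵢ nᵢ • Λ(εᵢ, c)` modulo `KZ.relations` for
algebraic `c`. Proof without division: with `P = ∏ εᵢ^{nᵢ⁺}`, `Q = ∏ εᵢ^{(−nᵢ)⁺}` one has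
`u · Q = P`, so `Λ(P) ≡ Λ(u) + Λ(Q)` (`carrier_mul_mem_relations`) while `Λ(P)`, `Λ(Q)` expand by
`carrier_prod_pow_sub_sum_mem_relations`, and `nᵢ⁺ − (−nᵢ)⁺ = nᵢ`.
[cite: KontsevichZagier2001, §1.2 rules (1), (2)] -/
theorem carrier_monomial_sub_sum_mem_relations {s : ℕ} {ε : Fin s → ℝ} (hε1 : ∀ i, 1 ≤ ε i)
    (hεalg : ∀ i, IsAlgebraic ℚ (ε i)) {c : ℝ} (hc : IsAlgebraic ℚ c) (n : Fin s → ℤ)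
    (hu1 : 1 ≤ ∏ i, ε i ^ n i) (L : IntegralRep 1)
    (hLd : L.domain = {x : Fin 1 → ℝ | x 0 ∈ Set.Ioo 1 (∏ i, ε i ^ n i)})
    (hLi : L.integrand = fun x => c / x 0) (L1 : Fin s → IntegralRep 1)
    (hd1 : ∀ i, (L1 i).domain = {x : Fin 1 → ℝ | x 0 ∈ Set.Ioo 1 (ε i)})
    (hi1 : ∀ i, (L1 i).integrand = fun x => c / x 0) :
    of L - ∑ i, n i • of (L1 i) ∈ relations := by
  have hε0 : ∀ i, ε i ≠ 0 := fun i => (lt_of_lt_of_le one_pos (hε1 i)).ne'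
  -- `P = ∏ εᵢ^{nᵢ⁺}`, `Q = ∏ εᵢ^{(−nᵢ)⁺}`, `u · Q = P`
  have hkey : (∏ i, ε i ^ n i) * ∏ i, ε i ^ (-n i).toNat = ∏ i, ε i ^ (n i).toNat := by
    rw [← Finset.prod_mul_distrib]
    exact Finset.prod_congr rfl fun i _ => zpow_mul_pow_toNat_neg (hε0 i) (n i)
  have halgu : IsAlgebraic ℚ (∏ i, ε i ^ n i) := isAlgebraic_prod_zpow _ ε n fun i _ => hεalg i
  have halgQ : IsAlgebraic ℚ (∏ i, ε i ^ (-n i).toNat) :=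
    isAlgebraic_prod_pow _ ε _ fun i _ => hεalg i
  have halgP : IsAlgebraic ℚ (∏ i, ε i ^ (n i).toNat) := isAlgebraic_prod_pow _ ε _ fun i _ => hεalg i
  have h1Q : 1 ≤ ∏ i, ε i ^ (-n i).toNat := one_le_prod_pow _ ε _ fun i _ => hε1 i
  obtain ⟨MP, hMPd, hMPi⟩ := exists_dlogA isAlgebraic_one halgP hc one_pos
    (b := ∏ i, ε i ^ (n i).toNat)
  obtain ⟨MQ, hMQd, hMQi⟩ := exists_dlogA isAlgebraic_one halgQ hc one_pos
    (b := ∏ i, ε i ^ (-n i).toNat)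
  -- `Λ(P) − Λ(u) − Λ(Q) ∈ relations`
  have h1 : of MP - of L - of MQ ∈ relations :=
    carrier_mul_mem_relations halgu halgQ hc hu1 h1Q MP L MQ (by rw [hMPd, hkey]) hMPi hLd hLi hMQd
      hMQi
  -- expansions of `Λ(P)` and `Λ(Q)`
  have h2 : of MP - ∑ i, (n i).toNat • of (L1 i) ∈ relations :=
    carrier_prod_pow_sub_sum_mem_relations hε1 hεalg hc (fun i => (n i).toNat) L1 hd1 hi1 _ MP hMPd
      hMPi
  have h3 : of MQ - ∑ i, (-n i).toNat • of (L1 i) ∈ relations :=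
    carrier_prod_pow_sub_sum_mem_relations hε1 hεalg hc (fun i => (-n i).toNat) L1 hd1 hi1 _ MQ hMQd
      hMQi
  -- bookkeeping: `nᵢ⁺ • x − (−nᵢ)⁺ • x = nᵢ • x`
  have h4 : ∀ i, n i • of (L1 i) =
      ((n i).toNat • of (L1 i) : FormalRep) - ((-n i).toNat • of (L1 i) : FormalRep) := fun i => by
    conv_lhs => rw [← Int.toNat_sub_toNat_neg (n i)]
    simp only [sub_eq_add_neg, add_zsmul, neg_zsmul, natCast_zsmul]
  simp_rw [h4, Finset.sum_sub_distrib]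
  have : of L - (∑ i, ((n i).toNat • of (L1 i) : FormalRep) -
      ∑ i, ((-n i).toNat • of (L1 i) : FormalRep)) =
      (of MP - ∑ i, ((n i).toNat • of (L1 i) : FormalRep)) -
        (of MQ - ∑ i, ((-n i).toNat • of (L1 i) : FormalRep)) - (of MP - of L - of MQ) := by abel
  rw [this]
  exact relations.sub_mem (relations.sub_mem h2 h3) h1

end AlgSplitK5

end Summit.KontsevichZagierPeriods.HurwitzMicroSectors.NormalFormPrinciple.PiBox
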